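import Mathlib.AlgebraicTopology.FundamentalGroupoid.SimplyConnected
import Literature.Topology.FourManifolds.FramedTubularNbhd
import Literature.Topology.FourManifolds.WhitneyModelSheets
import Literature.Topology.FourManifolds.EmbeddingTransport
import Literature.Topology.FourManifolds.SmaleHomologySpheresPropA

/-!
# Stub `stub_handlebodyChart` of line `mk_friends` for crux `DcrGap`: generic lemmas of the
# conditional reduction (item stmt-SmoothPoincare4-16128, route route-SmoothPoincare4-DottedCircleRasmussen)

Manifold-side tools consumed by the reduction `helper_handlebodyChart_of_facts2`
(`…DcrGapStubHandlebodyChartReduction.lean`), which closes stub D (global chart of the model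
dotted handlebody up to per-handle sphere twists) modulo the two Literature facts
`oneHandle_ambientIsotopic_upToTwist`, `arcs_ambientIsotopic_rel_of_homotopicRel` and the model
lemma `helper_handlebodyChart_modelHandles`.  Everything here is proved:

* `helper_handlebodyChart_chartData` — a germ chart `i` (smooth, injective, immersive on an open
  `U ⊆ ℝ⁴`) composed with a smooth injective immersion `ψ : ℝ⁴ → U` is a global smooth embedding
  AND an open embedding (inverse function theorem; registered helper);
* `handlebodyChart_germ_comp_diffeomorph` — a germ chart followed by a diffeomorphism of `X` is a
  germ chart;
* `handlebodyChart_transport` — a compactly supported diffeomorphism `κ` of `ℝ⁴` with support in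
  `U` is carried by a germ chart `f` on `U` to a diffeomorphism `Ξ` of `X` with `Ξ ∘ f = f ∘ κ` on
  `U` (`exists_diffeomorph_transport_of_isOpenEmbedding` applied to the open submanifold `U`);
* `handlebodyChart_simplyConnected_compl_ball` — in a simply connected `4`-manifold the complement
  of a chart image of an open round ball is simply connected
  (`SmaleHomologySpheres.simplyConnectedSpace_compl_image_ball`);
* `handlebodyChart_homotopy` — two arcs `[-1, 1] → X` which agree for `|t| ≥ 1/2` and whose middle
  thirds lie in a simply connected open set are joined by a homotopy rel `|t| ≥ 1/2` through that
  set (Mathlib's `SimplyConnectedSpace.paths_homotopic`, reparametrised to the plane `ℝ × ℝ`).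

References: J. M. Lee, *Introduction to Smooth Manifolds* (2013), Thm. 4.5, Prop. 5.2 [Lee2013];
M. W. Hirsch, *Differential Topology* (1976), Ch. 8 §1 [HirschDT1976]; A. Kosinski,
*Differential Manifolds* (1993), VI §2 [Kosinski1993].
-/

-- the prescribed namespace `Summit.<P>.<Sub>.…` duplicates `SmoothPoincare4` (P = Sub)
set_option linter.dupNamespace false

noncomputable section

open scoped Manifold ContDiff Topology unitInterval
open Function Set Metric
open Literature.Topology.FourManifolds

namespace Summit.SmoothPoincare4.SmoothPoincare4.Theorems.DcrGap.MkFriends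

/-- Local notation: `𝔼4` is `EuclideanSpace ℝ (Fin 4)`. -/
local notation "𝔼4" => EuclideanSpace ℝ (Fin 4)

/-! ## Germ charts composed with model immersions and with diffeomorphisms -/

/-- **Registered helper `helper_handlebodyChart_chartData`: a germ chart composed with a
self-immersion of `ℝ⁴` into its domain is a global chart, and an open embedding.**  If
`i : ℝ⁴ → X` is smooth, injective and immersive on the open set `U` of the `4`-manifold `X`, and
`ψ : ℝ⁴ → ℝ⁴` is smooth and injective with injective derivative everywhere and takes values in
`U`, then `i ∘ ψ` is smooth with injective differential everywhere (chain rule), hence a local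
diffeomorphism (inverse function theorem, `isLocalDiffeomorphAt_of_mfderiv_injective`), so a
smooth embedding (`isSmoothEmbedding_of_isLocalDiffeomorph`) and an open embedding
(`IsLocalHomeomorph.isOpenEmbedding_of_injective`); the last two conjuncts record the smoothness
and the injectivity of the differential for reuse.  Lee (2013), Thm. 4.5, Prop. 5.2. [folklore] -/
theorem helper_handlebodyChart_chartData : ∀ (X : Type) [TopologicalSpace X] [T2Space X] [SecondCountableTopology X] [ChartedSpace (EuclideanSpace ℝ (Fin 4)) X] [IsManifold (𝓡 4) ((⊤ : ℕ∞) : WithTop ℕ∞) X] (U : Set (EuclideanSpace ℝ (Fin 4))) (i : EuclideanSpace ℝ (Fin 4) → X) (ψ : EuclideanSpace ℝ (Fin 4) → EuclideanSpace ℝ (Fin 4)), (IsOpen U ∧ ContMDiffOn (𝓡 4) (𝓡 4) ((⊤ : ℕ∞) : WithTop ℕ∞) i U ∧ Set.InjOn i U ∧ (∀ x ∈ U, Function.Injective (mfderiv (𝓡 4) (𝓡 4) i x))) → ContDiff ℝ ((⊤ : ℕ∞) : WithTop ℕ∞) ψ → Function.Injective ψ → (∀ x, Function.Injective (fderiv ℝ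 ψ x)) → (∀ x, ψ x ∈ U) → Manifold.IsSmoothEmbedding (𝓡 4) (𝓡 4) ((⊤ : ℕ∞) : WithTop ℕ∞) (i ∘ ψ) ∧ Topology.IsOpenEmbedding (i ∘ ψ) ∧ ContMDiff (𝓡 4) (𝓡 4) ((⊤ : ℕ∞) : WithTop ℕ∞) (i ∘ ψ) ∧ (∀ x, Function.Injective (mfderiv (𝓡 4) (𝓡 4) (i ∘ ψ) x)) := by
  intro X _ _ _ _ _ U i ψ h hψs hψinj hψd hψU
  obtain ⟨hU, hi, hinj, hd⟩ := h
  have hψm : ContMDiff (𝓡 4) (𝓡 4) ∞ ψ := hψs.contMDiff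
  have hem : ContMDiff (𝓡 4) (𝓡 4) ∞ (i ∘ ψ) := hi.comp_contMDiff hψm hψU
  have heinj : Injective (i ∘ ψ) := fun x y hxy => hψinj (hinj (hψU x) (hψU y) hxy)
  have hn : (∞ : WithTop ℕ∞) ≠ 0 := by simp
  have hed : ∀ x, Injective (mfderiv (𝓡 4) (𝓡 4) (i ∘ ψ) x) := fun x => by
    have h1 : MDifferentiableAt (𝓡 4) (𝓡 4) i (ψ x) :=
      (hi.contMDiffAt (hU.mem_nhds (hψU x))).mdifferentiableAt hn
    have h2 : MDifferentiableAt (𝓡 4) (𝓡 4) ψ x := (hψm x).mdifferentiableAt hn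
    rw [mfderiv_comp x h1 h2]
    have h3 : mfderiv (𝓡 4) (𝓡 4) ψ x = fderiv ℝ ψ x := mfderiv_eq_fderiv
    rw [h3]
    exact (hd _ (hψU x)).comp (hψd x)
  have hloc : IsLocalDiffeomorph (𝓡 4) (𝓡 4) ∞ (i ∘ ψ) := fun x =>
    isLocalDiffeomorphAt_of_mfderiv_injective isOpen_univ (mem_univ x) hem.contMDiffOn
      (by exact_mod_cast le_top) rfl (hed x)
  exact ⟨isSmoothEmbedding_of_isLocalDiffeomorph hloc heinj (ContinuousLinearEquiv.refl ℝ _),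
    hloc.isLocalHomeomorph.isOpenEmbedding_of_injective heinj, hem, hed⟩

/-- **A germ chart followed by a diffeomorphism is a germ chart**: if `i` is smooth, injective and
immersive on `U` and `Φ` is a diffeomorphism of `X`, so is `Φ ∘ i` (the differential of `Φ` is a
linear isomorphism, `Diffeomorph.mfderivToContinuousLinearEquiv`). [folklore] -/
theorem handlebodyChart_germ_comp_diffeomorph {X : Type} [TopologicalSpace X]
    [ChartedSpace 𝔼4 X] [IsManifold (𝓡 4) ∞ X] {U : Set 𝔼4} (hU : IsOpen U) {i : 𝔼4 → X}
    (hi : ContMDiffOn (𝓡 4) (𝓡 4) ∞ i U) (hinj : InjOn i U)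
    (hd : ∀ x ∈ U, Injective (mfderiv (𝓡 4) (𝓡 4) i x)) (Φ : X ≃ₘ⟮𝓡 4, 𝓡 4⟯ X) :
    ContMDiffOn (𝓡 4) (𝓡 4) ∞ (Φ ∘ i) U ∧ InjOn (Φ ∘ i) U ∧
      ∀ x ∈ U, Injective (mfderiv (𝓡 4) (𝓡 4) (Φ ∘ i) x) := by
  refine ⟨Φ.contMDiff.comp_contMDiffOn hi, fun x hx y hy hxy => hinj hx hy (Φ.injective hxy),
    fun x hx => ?_⟩
  have hn : (∞ : WithTop ℕ∞) ≠ 0 := by simp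
  have h1 : MDifferentiableAt (𝓡 4) (𝓡 4) i x := (hi.contMDiffAt (hU.mem_nhds hx)).mdifferentiableAt hn
  have h2 : MDifferentiableAt (𝓡 4) (𝓡 4) Φ (i x) := Φ.contMDiff.contMDiffAt.mdifferentiableAt hn
  rw [mfderiv_comp x h2 h1]
  have h3 : Injective (mfderiv (𝓡 4) (𝓡 4) Φ (i x)) :=
    (Φ.mfderivToContinuousLinearEquiv hn (i x)).injective
  exact h3.comp (hd x hx)

/-! ## Transport of a compactly supported model diffeomorphism through a germ chart -/

/-- The inclusion of an open subset of `ℝ⁴` is a local diffeomorphism (its coercion partial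
homeomorphism is smooth with smooth inverse). [folklore] -/
theorem handlebodyChart_isLocalDiffeomorphAt_val (V : TopologicalSpace.Opens 𝔼4) (p : ↥V) :
    IsLocalDiffeomorphAt (𝓡 4) (𝓡 4) ∞ (Subtype.val : ↥V → 𝔼4) p := by
  have hne : Nonempty ↥V := ⟨p⟩
  set c := V.openPartialHomeomorphSubtypeCoe hne with hc
  have h1 : ContMDiffOn (𝓡 4) (𝓡 4) ∞ c c.source := by
    rw [TopologicalSpace.Opens.openPartialHomeomorphSubtypeCoe_source]
    exact (contMDiff_subtype_val.contMDiffOn (s := univ)).congr fun z _ => by simp [hc]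
  have h2 : ContMDiffOn (𝓡 4) (𝓡 4) ∞ c.symm c.target := by
    have key : EqOn (Subtype.val ∘ c.symm) id c.target := fun w hw => c.right_inv hw
    intro z hz
    have h : ContMDiffWithinAt (𝓡 4) (𝓡 4) ∞ (Subtype.val ∘ c.symm) c.target z :=
      contMDiffWithinAt_id.congr key (key hz)
    exact (ContMDiffWithinAt.subtypeVal_comp_iff V _ _ _).1 h
  let Φ : PartialDiffeomorph (𝓡 4) (𝓡 4) (↥V) 𝔼4 ∞ :=
    { toPartialEquiv := c.toPartialEquiv
      open_source := c.open_source
      open_target := c.open_target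
      contMDiffOn_toFun := h1
      contMDiffOn_invFun := h2 }
  refine ⟨Φ, ?_, fun q _ => rfl⟩
  show p ∈ c.source
  rw [TopologicalSpace.Opens.openPartialHomeomorphSubtypeCoe_source]
  exact mem_univ _

/-- **Transport of a compactly supported diffeomorphism of the model through a germ chart.**  Let
`f : ℝ⁴ → X` be smooth, injective and immersive on the open set `U` (`X` a Hausdorff
`4`-manifold) and `κ` a diffeomorphism of `ℝ⁴` equal to the identity off a compact `K ⊆ U`.
Then some diffeomorphism `Ξ` of `X` satisfies `Ξ (f y) = f (κ y)` for all `y ∈ U` (it is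
`f ∘ κ ∘ f⁻¹` on `f(U)` and the identity elsewhere: the tree's
`exists_diffeomorph_transport_of_isOpenEmbedding` for the open submanifold `U`, on which `f` is an
open smooth embedding by the inverse function theorem).  Hirsch (1976), Ch. 8 §1. [folklore] -/
theorem handlebodyChart_transport {X : Type} [TopologicalSpace X] [T2Space X]
    [ChartedSpace 𝔼4 X] [IsManifold (𝓡 4) ∞ X] {U : Set 𝔼4} (hU : IsOpen U) {f : 𝔼4 → X}
    (hf : ContMDiffOn (𝓡 4) (𝓡 4) ∞ f U) (hinj : InjOn f U)
    (hd : ∀ x ∈ U, Injective (mfderiv (𝓡 4) (𝓡 4) f x)) (κ : 𝔼4 ≃ₘ⟮𝓡 4, 𝓡 4⟯ 𝔼4)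
    {K : Set 𝔼4} (hK : IsCompact K) (hKU : K ⊆ U) (hκ : ∀ x, x ∉ K → κ x = x) :
    ∃ Ξ : X ≃ₘ⟮𝓡 4, 𝓡 4⟯ X, ∀ y ∈ U, Ξ (f y) = f (κ y) := by
  -- `κ` and `κ⁻¹` preserve `U`
  have hκ' : ∀ x, x ∉ K → κ.symm x = x := fun x hx => by
    conv_lhs => rw [← hκ x hx]
    exact κ.symm_apply_apply x
  have hκU : ∀ y ∈ U, κ y ∈ U := fun y hy => by
    by_contra h
    have h1 : κ (κ y) = κ y := hκ _ fun h' => h (hKU h')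
    exact h (by rw [κ.injective h1]; exact hy)
  have hκU' : ∀ y ∈ U, κ.symm y ∈ U := fun y hy => by
    by_contra h
    have h1 : κ.symm (κ.symm y) = κ.symm y := hκ' _ fun h' => h (hKU h')
    exact h (by rw [κ.symm.injective h1]; exact hy)
  by_cases hne : U.Nonempty
  swap
  · refine ⟨Diffeomorph.refl (𝓡 4) X ∞, fun y hy => (hne ⟨y, hy⟩).elim⟩
  let V : TopologicalSpace.Opens 𝔼4 := ⟨U, hU⟩
  haveI : Nonempty ↥V := let ⟨y, hy⟩ := hne; ⟨⟨y, hy⟩⟩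
  -- the restriction of `f` to the open submanifold `U`
  let ι : ↥V → X := f ∘ Subtype.val
  have hιm : ContMDiff (𝓡 4) (𝓡 4) ∞ ι := hf.comp_contMDiff contMDiff_subtype_val fun y => y.2
  have hιinj : Injective ι := fun y y' h => Subtype.ext (hinj y.2 y'.2 h)
  have hloc : IsLocalDiffeomorph (𝓡 4) (𝓡 4) ∞ ι := fun p => by
    have h1 : IsLocalDiffeomorphAt (𝓡 4) (𝓡 4) ∞ f (Subtype.val p) :=
      isLocalDiffeomorphAt_of_mfderiv_injective hU p.2 hf (by exact_mod_cast le_top) rfl (hd _ p.2)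
    exact (handlebodyChart_isLocalDiffeomorphAt_val V p).comp (K := 𝓡 4) (P := X) h1
  have hsm : Manifold.IsSmoothEmbedding (𝓡 4) (𝓡 4) ∞ ι :=
    isSmoothEmbedding_of_isLocalDiffeomorph hloc hιinj (ContinuousLinearEquiv.refl ℝ _)
  have ho : IsOpen (range ι) := hloc.isLocalHomeomorph.isOpenMap.isOpen_range
  -- the restriction of `κ` to `U`
  let ξ : ↥V ≃ₘ⟮𝓡 4, 𝓡 4⟯ ↥V :=
    { toFun := fun p => ⟨κ p, hκU _ p.2⟩
      invFun := fun p => ⟨κ.symm p, hκU' _ p.2⟩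
      left_inv := fun p => Subtype.ext (κ.symm_apply_apply _)
      right_inv := fun p => Subtype.ext (κ.apply_symm_apply _)
      contMDiff_toFun := (ContMDiff.subtypeVal_comp_iff V _).1
        (κ.contMDiff.comp contMDiff_subtype_val)
      contMDiff_invFun := (ContMDiff.subtypeVal_comp_iff V _).1
        (κ.symm.contMDiff.comp contMDiff_subtype_val) }
  have hKV : IsCompact (Subtype.val ⁻¹' K : Set ↥V) := by
    rw [Subtype.isCompact_iff]
    convert hK using 1
    ext x
    constructor
    · rintro ⟨y, hy, rfl⟩; exact hy
    · intro hx; exact ⟨⟨x, hKU hx⟩, hx, rfl⟩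
  have hξ : ∀ p : ↥V, p ∉ (Subtype.val ⁻¹' K : Set ↥V) → ξ p = p := fun p hp =>
    Subtype.ext (hκ _ hp)
  obtain ⟨Ξ, hΞ, -⟩ := exists_diffeomorph_transport_of_isOpenEmbedding hsm ho ξ hKV hξ
  exact ⟨Ξ, fun y hy => hΞ ⟨y, hy⟩⟩

/-! ## Simple connectivity of the complement of a small chart ball -/

/-- **In a simply connected `4`-manifold the complement of a chart image of an open round ball is
simply connected** (general position off a point and the radial retraction; the tree's
`SmaleHomologySpheres.simplyConnectedSpace_compl_image_ball`, after normalising the ball by the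
affine map `y ↦ c + r y`).  Kosinski (1993), VI §2. [folklore] -/
theorem handlebodyChart_simplyConnected_compl_ball {X : Type} [TopologicalSpace X] [T2Space X]
    [ChartedSpace 𝔼4 X] [SimplyConnectedSpace X] {e : 𝔼4 → X}
    (he : Topology.IsOpenEmbedding e) (c : 𝔼4) {r : ℝ} (hr : 0 < r) :
    SimplyConnectedSpace ↥((e '' ball c r)ᶜ) := by
  let α : 𝔼4 ≃ₜ 𝔼4 := (Homeomorph.smulOfNeZero r hr.ne').trans (Homeomorph.addLeft c)
  have hα : ∀ y, α y = c + r • y := fun y => rfl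
  have hι : Topology.IsOpenEmbedding (e ∘ α) := he.comp α.isOpenEmbedding
  have himg : (e ∘ α) '' ball 0 1 = e '' ball c r := by
    rw [image_comp]
    congr 1
    ext x
    simp only [mem_image, mem_ball, hα, dist_eq_norm]
    constructor
    · rintro ⟨y, hy, rfl⟩
      rw [add_sub_cancel_left, norm_smul, Real.norm_of_nonneg hr.le]
      rw [sub_zero] at hy
      nlinarith
    · intro hx
      refine ⟨r⁻¹ • (x - c), ?_, ?_⟩
      · rw [sub_zero, norm_smul, norm_inv, Real.norm_of_nonneg hr.le,
          inv_mul_lt_iff₀ hr]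
        linarith
      · rw [smul_smul, mul_inv_cancel₀ hr.ne', one_smul, add_sub_cancel]
  have h := SmaleHomologySpheres.simplyConnectedSpace_compl_image_ball (M := X) (n := 4)
    (by norm_num) hι
  rwa [himg] at h

/-! ## Homotopies of arcs rel their outer thirds -/

/-- **Homotopy of two arcs rel their ends through a simply connected open set.**  Let
`f₀, f₁ : ℝ → X` be continuous on `[-1, 1]`, equal for `1/2 ≤ |t| ≤ 1`, and suppose the middle
parts `fᵢ t`, `|t| ≤ 1/2`, lie in the complement of a set `S` with `X ∖ S` simply connected.  Then
there is a continuous `H : ℝ × ℝ → X` with `H (0, ·) = f₀`, `H (1, ·) = f₁` on `[-1, 1]`,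
stationary (`= f₀ t`) for `|t| ≥ 1/2`, and off `S` for `|t| ≤ 1/2` (`s ∈ [0, 1]`): the path
homotopy of Mathlib's `SimplyConnectedSpace.paths_homotopic` in `X ∖ S`, reparametrised and
extended constantly. [folklore] -/
theorem handlebodyChart_homotopy {X : Type} [TopologicalSpace X] (S : Set X)
    [hS : SimplyConnectedSpace ↥(Sᶜ)] (f₀ f₁ : ℝ → X) (h₀ : ContinuousOn f₀ (Icc (-1) 1))
    (h₁ : ContinuousOn f₁ (Icc (-1) 1)) (hagree : ∀ t, 1 / 2 ≤ |t| → |t| ≤ 1 → f₀ t = f₁ t)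
    (hS₀ : ∀ t, |t| ≤ 1 / 2 → f₀ t ∉ S) (hS₁ : ∀ t, |t| ≤ 1 / 2 → f₁ t ∉ S) :
    ∃ H : ℝ × ℝ → X, Continuous H ∧ (∀ t ∈ Icc (-1 : ℝ) 1, H (0, t) = f₀ t ∧ H (1, t) = f₁ t) ∧
      (∀ s ∈ Icc (0 : ℝ) 1, ∀ t ∈ Icc (-1 : ℝ) 1, 1 / 2 ≤ |t| → H (s, t) = f₀ t) ∧
      (∀ s ∈ Icc (0 : ℝ) 1, ∀ t ∈ Icc (-1 : ℝ) 1, |t| ≤ 1 / 2 → H (s, t) ∉ S) := by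
  -- the two middle parts as paths in `X ∖ S`
  have hu : ∀ u : I, |(u : ℝ) - 1 / 2| ≤ 1 / 2 := fun u => by
    rw [abs_le]; constructor <;> linarith [u.2.1, u.2.2]
  have hu' : ∀ u : I, (u : ℝ) - 1 / 2 ∈ Icc (-1 : ℝ) 1 := fun u => by
    constructor <;> linarith [u.2.1, u.2.2]
  have hc₀ : Continuous fun u : I => (⟨f₀ ((u : ℝ) - 1 / 2), hS₀ _ (hu u)⟩ : ↥(Sᶜ)) :=
    (h₀.comp_continuous (continuous_subtype_val.sub continuous_const) hu').subtype_mk _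
  have hc₁ : Continuous fun u : I => (⟨f₁ ((u : ℝ) - 1 / 2), hS₁ _ (hu u)⟩ : ↥(Sᶜ)) :=
    (h₁.comp_continuous (continuous_subtype_val.sub continuous_const) hu').subtype_mk _
  have hna : |(-(1 / 2) : ℝ)| = 1 / 2 := by rw [abs_neg, abs_of_pos (by norm_num : (0 : ℝ) < 1 / 2)]
  have hpa : |((1 / 2) : ℝ)| = 1 / 2 := abs_of_pos (by norm_num)
  have ha : f₁ (-(1 / 2)) = f₀ (-(1 / 2)) :=
    (hagree _ (by rw [hna]) (by rw [hna]; norm_num)).symm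
  have hb : f₁ (1 / 2) = f₀ (1 / 2) :=
    (hagree _ (by rw [hpa]) (by rw [hpa]; norm_num)).symm
  let xa : ↥(Sᶜ) := ⟨f₀ (-(1 / 2)), hS₀ _ (by rw [hna])⟩
  let xb : ↥(Sᶜ) := ⟨f₀ (1 / 2), hS₀ _ (by rw [hpa])⟩
  let γ₀ : Path xa xb :=
    { toFun := fun u => ⟨f₀ ((u : ℝ) - 1 / 2), hS₀ _ (hu u)⟩
      continuous_toFun := hc₀
      source' := by apply Subtype.ext; show f₀ ((0 : ℝ) - 1 / 2) = f₀ (-(1 / 2)); norm_num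
      target' := by apply Subtype.ext; show f₀ ((1 : ℝ) - 1 / 2) = f₀ (1 / 2); norm_num }
  let γ₁ : Path xa xb :=
    { toFun := fun u => ⟨f₁ ((u : ℝ) - 1 / 2), hS₁ _ (hu u)⟩
      continuous_toFun := hc₁
      source' := by
        apply Subtype.ext; show f₁ ((0 : ℝ) - 1 / 2) = f₀ (-(1 / 2)); rw [← ha]; norm_num
      target' := by
        apply Subtype.ext; show f₁ ((1 : ℝ) - 1 / 2) = f₀ (1 / 2); rw [← hb]; norm_num }
  obtain ⟨F⟩ := SimplyConnectedSpace.paths_homotopic γ₀ γ₁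
  -- the glued homotopy on the plane
  let A : ℝ × ℝ → X := fun q =>
    (F (projIcc 0 1 zero_le_one q.1, projIcc 0 1 zero_le_one (q.2 + 1 / 2)) : X)
  let B : ℝ × ℝ → X := fun q => f₀ (projIcc (-1) 1 (by norm_num) q.2)
  have hA : Continuous A :=
    continuous_subtype_val.comp (F.continuous.comp
      ((continuous_projIcc.comp continuous_fst).prodMk
        (continuous_projIcc.comp (continuous_snd.add continuous_const))))
  have hB : Continuous B :=
    h₀.comp_continuous (continuous_subtype_val.comp (continuous_projIcc.comp continuous_snd))
      fun q => (projIcc (-1) 1 _ q.2).2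
  -- values of `A` on the two boundary lines
  have hA_half : ∀ s : ℝ, A (s, 1 / 2) = f₀ (1 / 2) := fun s => by
    show (F (projIcc 0 1 zero_le_one s, projIcc 0 1 zero_le_one ((1 : ℝ) / 2 + 1 / 2)) : X) = _
    have : projIcc 0 1 zero_le_one ((1 : ℝ) / 2 + 1 / 2) = 1 := by
      rw [show (1 : ℝ) / 2 + 1 / 2 = 1 by norm_num]; exact projIcc_right _
    rw [this, F.target]
  have hA_neg : ∀ s : ℝ, A (s, -(1 / 2)) = f₀ (-(1 / 2)) := fun s => by
    show (F (projIcc 0 1 zero_le_one s, projIcc 0 1 zero_le_one (-((1 : ℝ) / 2) + 1 / 2)) : X) = _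
    have : projIcc 0 1 zero_le_one (-((1 : ℝ) / 2) + 1 / 2) = 0 := by
      rw [show -((1 : ℝ) / 2) + 1 / 2 = 0 by norm_num]; exact projIcc_left _
    rw [this, F.source]
  have hAB : ∀ q : ℝ × ℝ, |q.2| = 1 / 2 → A q = B q := by
    rintro ⟨s, t⟩ ht
    rcases (abs_eq (by norm_num : (0 : ℝ) ≤ 1 / 2)).1 ht with rfl | rfl
    · rw [hA_half]; show f₀ (1 / 2) = f₀ (projIcc (-1) 1 _ (1 / 2 : ℝ))
      rw [projIcc_of_mem _ (by constructor <;> norm_num)]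
    · rw [hA_neg]; show f₀ (-(1 / 2)) = f₀ (projIcc (-1) 1 _ (-(1 / 2) : ℝ))
      rw [projIcc_of_mem _ (by constructor <;> norm_num)]
  refine ⟨fun q => if |q.2| ≤ 1 / 2 then A q else B q, ?_, ?_, ?_, ?_⟩
  · exact hA.if_le hB (continuous_abs.comp continuous_snd) continuous_const hAB
  · rintro t ht
    have hB' : B (0, t) = f₀ t ∧ B (1, t) = f₀ t := by
      constructor <;> · show f₀ (projIcc (-1) 1 _ t) = f₀ t; rw [projIcc_of_mem _ ht]
    by_cases hth : |t| ≤ 1 / 2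
    · have ht' : t + 1 / 2 ∈ Icc (0 : ℝ) 1 := by
        rw [abs_le] at hth; constructor <;> linarith [hth.1, hth.2]
      simp only [hth, if_true]
      constructor
      · show (F (projIcc 0 1 zero_le_one 0, projIcc 0 1 zero_le_one (t + 1 / 2)) : X) = f₀ t
        have h0 : projIcc (0 : ℝ) 1 zero_le_one 0 = 0 := projIcc_left _
        rw [h0, F.apply_zero, projIcc_of_mem _ ht']
        show f₀ (t + 1 / 2 - 1 / 2) = f₀ t
        rw [add_sub_cancel_right]
      · show (F (projIcc 0 1 zero_le_one 1, projIcc 0 1 zero_le_one (t + 1 / 2)) : X) = f₁ t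
        have h1' : projIcc (0 : ℝ) 1 zero_le_one 1 = 1 := projIcc_right _
        rw [h1', F.apply_one, projIcc_of_mem _ ht']
        show f₁ (t + 1 / 2 - 1 / 2) = f₁ t
        rw [add_sub_cancel_right]
    · simp only [hth, if_false]
      refine ⟨hB'.1, hB'.2.trans (hagree t (le_of_lt (not_le.1 hth)) (abs_le.2 ⟨by linarith [ht.1], ht.2⟩))⟩
  · rintro s - t ht hth
    by_cases hth' : |t| ≤ 1 / 2
    · have heq : |t| = 1 / 2 := le_antisymm hth' hth
      simp only [hth', if_true]
      rw [hAB (s, t) heq]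
      show f₀ (projIcc (-1) 1 _ t) = f₀ t
      rw [projIcc_of_mem _ ht]
    · simp only [hth', if_false]
      show f₀ (projIcc (-1) 1 _ t) = f₀ t
      rw [projIcc_of_mem _ ht]
  · rintro s - t - hth
    simp only [hth, if_true]
    exact (F (projIcc 0 1 zero_le_one s, projIcc 0 1 zero_le_one (t + 1 / 2))).2

end Summit.SmoothPoincare4.SmoothPoincare4.Theorems.DcrGap.MkFriends

end
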